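import Summits.BirchSwinnertonDyer.BirchSwinnertonDyer.Theorems.PrintCf2RubinValueTwoKatzMeasureJZeroSeamValuesReadingField
import Summits.BirchSwinnertonDyer.BirchSwinnertonDyer.Theorems.PrintCf2RubinValueTwoKatzMeasureJZeroSeamLevelConstant
import Summits.BirchSwinnertonDyer.BirchSwinnertonDyer.Theorems.PrintCf2RubinValueTwoKatzMeasureJZeroSeamValuesOfLabelData
import Summits.BirchSwinnertonDyer.BirchSwinnertonDyer.Theorems.PrintCf2RubinValueTwoKatzMeasureJZeroFrameSevenConjugate
import Literature.NumberTheory.GaloisRepresentations.LubinTateColemanRelativeMomentsBaseChangeTwo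
import Literature.NumberTheory.EllipticCurves.FormalGroupLubinTateDivisionPointsTateUnitEnlarge
import HarnessLib

/-!
# The per-unit values of the `j = 0` seam for ONE LABEL at one level of the lane ([I2] file 3a = FILE-1 ∘ V1-enlarge ∘ U4 ∘ [I4]; proofs only)

Cell `bsd-print-cf2`, width seat `bsd-line-cf2-p1-w8` g14 (piece [I2] of the SEAM, file 3a); `--supports` the crux stmt-BirchSwinnertonDyer-20368
(helper, Theses-free).  THEOREMS ONLY; no `def`, no named fact, no `sorry`.
`forall_moment_eq_of_label`: on the principal-split `cm7` lane (`v = (α₀)`, `v̄ = (1 − α₀)`, `ℤ₂`-datum `P = exp_W(c·log_W)` of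
`W = [1,−1,0,−2,−1]`, `Λ_L = Ω_E·w₀(𝓞_K)`), for the level modulus `𝔪 = (μ) ≤ (v̄³)` prime to `v`, the level's coefficient field `E`
(its own `α`-datum is not needed: the enlarged reading field carries one), a unit `β ∈ 𝒰_E` reading `Θ(1; 𝔪v^{m+1}, 𝔞)` for a label `𝔞 = (a)` prime to `𝔪v`, the Grössencharacter clauses of II.1.5 (hypotheses,
from the named fact `DeShalit1987.prop15_grossencharacterReciprocity`), the reading conjugacy `τ_K` (Q-θ), the REFERENCE division points of
`Λ_L = Ω_ref·w₀(v̄³)` read in `E₀` with Tate unit `a₀`, and three pointwise `𝔓`-INTEGRALITY ORACLES (de Shalit II.4.9 (i); hypotheses, RP-INT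
discharges them): **there is `𝔟′` prime to `𝔣ψ·𝔪𝔞·v` with `τ_K⁻¹|_{K(𝔣ψ𝔪𝔞v)} = (𝔟′, ·)` such that, read in `E`,
`θ(c_{β,k}) = (θ(a₀)Φ(v̄³)/Φ(μ))^{k+1}·ι_p⁻¹(−12(N𝔞·E_{k+1}(ψ(𝔟′)Ω_𝔪; L) − E_{k+1}(ψ(𝔟′)Ω_𝔪; 𝔞⁻¹L)))` and the Frobenius twin at
`ψ(𝔟′v)Ω_𝔪`** (`Ω_𝔪 = Ω_E/w₀ μ`, `Φ = ι_p⁻¹ ∘ w₀`).  Proof: `exists_readingField` / `exists_thetaData_of_label` / `exists_labelIdeal` (Data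
file), FILE-1 `exists_tateUnit_and_forall_readingHom_moment_eq_of_readingField` over `E*` for `β ⊗ E*`, descent of the moments (V1-enlarge
`unitBallToCBall_moment_baseChange`), U4 `forall_ptOfZ_hom_hom_cohPt_eq_of_le` + [I4] `tateUnit_eq_mul_of_lane_of_torsionReadings` /
`levelConstant_eq_of_tateUnit_eq_mul`.  No summit statement is proved; BSD is not proved by any of this.

## References
* [deShalit1987] E. de Shalit, *Iwasawa theory of elliptic curves with complex multiplication* (1987), II §1.5 (15), II §4.3 (p. 57), II §4.4,
  II §4.9 (i)(ii) (p. 62–63), II §4.10 (26), II §4.14 (38) (p. 71).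
* [SilvermanAEC2009] J. H. Silverman, *The Arithmetic of Elliptic Curves*, 2nd ed. (2009), III.2.3, VII.2.2.
-/

-- the summit namespace `Summit.BirchSwinnertonDyer.BirchSwinnertonDyer` repeats the problem name by design (D-0017)
set_option linter.dupNamespace false
set_option autoImplicit false

noncomputable section

open scoped Classical
open scoped NumberField
open PowerSeries IsDedekindDomain IsDedekindDomain.HeightOneSpectrum NumberField ValuativeRel Field PeriodPair
open Literature.NumberTheory.NumberFields Literature.NumberTheory.EllipticCurves Literature.NumberTheory.EllipticCurves.DeShalit1987
  Literature.NumberTheory.EllipticCurves.DivisionPointReadings Literature.NumberTheory.ComplexMultiplication.EllipticUnits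
open Literature.NumberTheory.GaloisRepresentations Literature.NumberTheory.GaloisRepresentations.IsNonarchimedeanLocalField
  Literature.NumberTheory.GaloisRepresentations.LubinTate Literature.NumberTheory.EllipticCurves.FormalGroupChart Literature.NumberTheory.PAdicHodge
  _root_.WeierstrassCurve
open Literature.NumberTheory.LFunctions.AbelianDensity (artinSymbol)
open Summit.BirchSwinnertonDyer.BirchSwinnertonDyer.Theorems.PrintCf2.KatzMeasureJZeroTop
  Summit.BirchSwinnertonDyer.BirchSwinnertonDyer.Theorems.PrintCf2.EllipticUnitsLocal

namespace Summit.BirchSwinnertonDyer.BirchSwinnertonDyer.Theorems.PrintCf2.KatzMeasureJZeroSeam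

attribute [local instance] ltNormUniformSpace ltNormIsUniformAddGroup rk1 nF nE fintypeResidueField

variable {K : Type} [Field K] [NumberField K]

set_option maxHeartbeats 6400000 in
/-- ★★★ **The per-unit values for one label at one level of the lane, Tate unit identified against the reference** (see the module
docstring). [cite: deShalit1987, II §1.5 (15), II §4.3 (p. 57), II §4.4 (iv), II §4.9 (i)(ii) (p. 62–63), II §4.10 (26), II §4.14 (38) (p. 71)]
[cite: SilvermanAEC2009, III.2.3, VII.2.2] -/
theorem forall_moment_eq_of_label
    -- the base field (imaginary quadratic), the split prime `v = (α₀) ∣ 2` of degree one, `v̄ = (1 − α₀)`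
    [IsTotallyComplex K] (hK : IsImaginaryQuadratic K) (v : HeightOneSpectrum (𝓞 K)) [v.asIdeal.LiesOver (ratPlace 2).asIdeal]
    (he : v.asIdeal.ramificationIdx (𝓞 ℚ) = 1) (hf : v.asIdeal.inertiaDeg (𝓞 ℚ) = 1)
    {α₀ : 𝓞 K} (hv0 : v.asIdeal = Ideal.span {α₀}) (hα₀ : α₀ ^ 2 - α₀ + 2 = 0) (hprime₁ : Prime (1 - α₀))
    (hq : residueFieldCard (v.adicCompletion K) = 2)
    (h2 : (valuation (v.adicCompletion K)).IsUniformizer ((((2 : ℕ) : 𝒪[v.adicCompletion K]) : v.adicCompletion K)))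
    (u : 𝒪[v.adicCompletion K]ˣ)
    (hu : ((((u : 𝒪[v.adicCompletion K]) * ((2 : ℕ) : 𝒪[v.adicCompletion K]) : 𝒪[v.adicCompletion K]) : v.adicCompletion K)) =
      ((α₀ : K) : v.adicCompletion K))
    -- the lane's `ℤ₂`-datum of `W = [1,−1,0,−2,−1]`
    {c : ℤ_[2]} {P : PowerSeries ℤ_[2]}
    (hPexp : P.map PadicInt.Coe.ringHom = ((⟨1, -1, 0, -2, -1⟩ : WeierstrassCurve ℤ_[2]).map PadicInt.Coe.ringHom).formalExp.subst
      (C (c : ℚ_[2]) * ((⟨1, -1, 0, -2, -1⟩ : WeierstrassCurve ℤ_[2]).map PadicInt.Coe.ringHom).formalLog))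
    (hA : IsLTRing c 2) (hPlt : IsLTSeries c 2 P)
    (heπ : ((integerEquivAdicCompletionIntegers v).trans (padicIntEquivOfDegreeOne K 2 v he hf))
      ((u : 𝒪[v.adicCompletion K]) * ((2 : ℕ) : 𝒪[v.adicCompletion K])) = c)
    (hc : padicEquivOfDegreeOne K 2 v he hf (algebraMap K (v.adicCompletion K) (α₀ : K)) = c)
    (hV : (((⟨1, -1, 0, -2, -1⟩ : WeierstrassCurve ℤ)).map (Int.castRingHom ℤ_[2])).formalGroupLaw = ltF hA hPlt)
    {ϖ : ℤ_[2]} (hp : ((2 : ℕ) : ℤ_[2]) = ϖ * c) (hϖ : IsUnit ϖ)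
    -- the level's coefficient field `E` (finite Galois unramified) and a local Frobenius
    (E : IntermediateField (v.adicCompletion K) (AlgebraicClosure (v.adicCompletion K)))
    [FiniteDimensional (v.adicCompletion K) E] [IsGalois (v.adicCompletion K) E]
    (hE : E ≤ maxUnramified (v.adicCompletion K)) {σ₀ : absoluteGaloisGroup (v.adicCompletion K)} (hσ₀ : IsAbsArithFrob σ₀)
    -- the two readings `θ`, `ι_p` conjugate through `τ_K` (Q-θ); `w₀ : K → ℂ`
    (θ : CompletedAlgClosure (v.adicCompletion K) →+* ℂ_[2]) (ιp : PadicAlgCl 2 ≃+* ℂ) (w₀ : InfinitePlace K) {τK : absoluteGaloisGroup K}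
    (hτK : ∀ x : AlgebraicClosure K,
      θ (algClosureToC (v.adicCompletion K) (absClosureEmbedding K (v.adicCompletion K) (τK • x))) =
        algebraMap (PadicAlgCl 2) ℂ_[2] (ιp.symm (algClosureEmb w₀.embedding x)))
    (hw : w₀.embedding (α₀ : K) ^ 2 = w₀.embedding (α₀ : K) - 2)
    -- the model lattice `Λ_L = Ω_E·w₀(𝓞_K)` of `W ⊗ ℂ`
    (L : PeriodPair) {ΩE : ℂ} (hLE : ∀ z : ℂ, z ∈ L.lattice ↔ ∃ a : 𝓞 K, z = ΩE * w₀.embedding (a : K)) (hΩE : ΩE ≠ 0)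
    (h₂ : L.g₂ = (((⟨1, -1, 0, -2, -1⟩ : WeierstrassCurve ℤ)).baseChange ℂ).c₄ / 12)
    (h₃ : L.g₃ = (((⟨1, -1, 0, -2, -1⟩ : WeierstrassCurve ℤ)).baseChange ℂ).c₆ / 216)
    -- the Grössencharacter: conductor `𝔣ψ` prime to `v`, clauses (ii)–(iv), `ψ(v) = α₀`, clauses (vi)/(vii) of II.1.5 (hypotheses)
    (ψK : Ideal (𝓞 K) → 𝓞 K) {𝔣ψ : Ideal (𝓞 K)} (h𝔣ψ0 : 𝔣ψ ≠ ⊥) (hv𝔣ψ : ¬ 𝔣ψ ≤ v.asIdeal)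
    (hψmul : ∀ 𝔞 𝔟 : Ideal (𝓞 K), IsCoprime 𝔞 𝔣ψ → IsCoprime 𝔟 𝔣ψ → ψK (𝔞 * 𝔟) = ψK 𝔞 * ψK 𝔟)
    (hψspan : ∀ 𝔞 : Ideal (𝓞 K), IsCoprime 𝔞 𝔣ψ → Ideal.span {ψK 𝔞} = 𝔞) (hψv : ψK v.asIdeal = α₀)
    (h6 : ∀ 𝔠 : Ideal (𝓞 K), 𝔠 ≠ ⊥ → ∀ z : ℂ, z ∈ idealInvLattice w₀.embedding 𝔠 L.lattice → z ∉ L.lattice →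
      ∃ x y : rayClassField K (𝔣ψ * 𝔠), algClosureEmb w₀.embedding x = ℘[L] z ∧ algClosureEmb w₀.embedding y = ℘'[L] z)
    (h7 : ∀ 𝔠 : Ideal (𝓞 K), 𝔠 ≠ ⊥ → ∀ z : ℂ, z ∈ idealInvLattice w₀.embedding 𝔠 L.lattice → z ∉ L.lattice →
      ∀ 𝔟 : Ideal (𝓞 K), IsCoprime 𝔟 (𝔣ψ * 𝔠) → ∀ x y : rayClassField K (𝔣ψ * 𝔠),
        algClosureEmb w₀.embedding x = ℘[L] z → algClosureEmb w₀.embedding y = ℘'[L] z →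
          algClosureEmb w₀.embedding (artinSymbol (galFrob K (rayClassField K (𝔣ψ * 𝔠))) 𝔟 x) = ℘[L] (w₀.embedding (ψK 𝔟 : K) * z) ∧
          algClosureEmb w₀.embedding (artinSymbol (galFrob K (rayClassField K (𝔣ψ * 𝔠))) 𝔟 y) = ℘'[L] (w₀.embedding (ψK 𝔟 : K) * z))
    -- the `𝔓`-INTEGRALITY ORACLES (de Shalit II.4.9 (i), pointwise; hypotheses)
    (hIx : ∀ (𝔠 : Ideal (𝓞 K)), 𝔠 ≠ ⊥ → ¬ 𝔠 ≤ v.asIdeal → ∀ z : ℂ, z ∈ idealInvLattice w₀.embedding 𝔠 L.lattice → z ∉ L.lattice →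
      ∀ {𝔐 : Ideal (𝓞 K)} (F : IntermediateField (v.adicCompletion K) (AlgebraicClosure (v.adicCompletion K)))
        [FiniteDimensional (v.adicCompletion K) F]
        (hF : ∀ y : AlgebraicClosure K, y ∈ rayClassField K 𝔐 → absClosureEmbedding K (v.adicCompletion K) y ∈ F) (X : rayClassField K 𝔐),
        algClosureEmb w₀.embedding X = ℘[L] z - (((⟨1, -1, 0, -2, -1⟩ : WeierstrassCurve ℤ)).baseChange ℂ).b₂ / 12 → X ∈ readingRing F hF)
    (hIy : ∀ (𝔠 : Ideal (𝓞 K)), 𝔠 ≠ ⊥ → ¬ 𝔠 ≤ v.asIdeal → ∀ z : ℂ, z ∈ idealInvLattice w₀.embedding 𝔠 L.lattice → z ∉ L.lattice →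
      ∀ {𝔐 : Ideal (𝓞 K)} (F : IntermediateField (v.adicCompletion K) (AlgebraicClosure (v.adicCompletion K)))
        [FiniteDimensional (v.adicCompletion K) F]
        (hF : ∀ y : AlgebraicClosure K, y ∈ rayClassField K 𝔐 → absClosureEmbedding K (v.adicCompletion K) y ∈ F) (Y : rayClassField K 𝔐),
        algClosureEmb w₀.embedding Y = (℘'[L] z - (((⟨1, -1, 0, -2, -1⟩ : WeierstrassCurve ℤ)).baseChange ℂ).a₁ *
          (℘[L] z - (((⟨1, -1, 0, -2, -1⟩ : WeierstrassCurve ℤ)).baseChange ℂ).b₂ / 12) - (((⟨1, -1, 0, -2, -1⟩ : WeierstrassCurve ℤ)).baseChange ℂ).a₃) / 2 →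
        Y ∈ readingRing F hF)
    (hIu : ∀ (𝔠 : Ideal (𝓞 K)), 𝔠 ≠ ⊥ → ¬ 𝔠 ≤ v.asIdeal → ∀ z₁ z₂ : ℂ, z₁ ∈ idealInvLattice w₀.embedding 𝔠 L.lattice →
      z₂ ∈ idealInvLattice w₀.embedding 𝔠 L.lattice → z₁ ∉ L.lattice → z₂ ∉ L.lattice → z₁ - z₂ ∉ L.lattice → z₁ + z₂ ∉ L.lattice →
      ∀ {𝔐 : Ideal (𝓞 K)} (F : IntermediateField (v.adicCompletion K) (AlgebraicClosure (v.adicCompletion K)))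
        [FiniteDimensional (v.adicCompletion K) F]
        (hF : ∀ y : AlgebraicClosure K, y ∈ rayClassField K 𝔐 → absClosureEmbedding K (v.adicCompletion K) y ∈ F) (X₁ X₂ : rayClassField K 𝔐),
        algClosureEmb w₀.embedding X₁ = ℘[L] z₁ - (((⟨1, -1, 0, -2, -1⟩ : WeierstrassCurve ℤ)).baseChange ℂ).b₂ / 12 →
        algClosureEmb w₀.embedding X₂ = ℘[L] z₂ - (((⟨1, -1, 0, -2, -1⟩ : WeierstrassCurve ℤ)).baseChange ℂ).b₂ / 12 →
        ‖(readingFieldHom F hF (X₁ - X₂) : F)‖ = 1)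
    -- the REFERENCE presentation `Λ_L = Ω_ref·w₀(v̄³)` (`Ω_ref = Ω_E/w₀((1−α₀)³)`, `β_r α₀ ≡ 1 (mod v̄³)`) read in `E₀`, Tate unit `a₀`
    (E₀ : IntermediateField (v.adicCompletion K) (AlgebraicClosure (v.adicCompletion K)))
    [FiniteDimensional (v.adicCompletion K) E₀] [IsGalois (v.adicCompletion K) E₀] (hE₀ : E₀ ≤ maxUnramified (v.adicCompletion K))
    {βr : 𝓞 K} (hβr : βr * α₀ - 1 ∈ Ideal.span {(1 - α₀) ^ 3})
    [hEll₀ : ∀ m : ℕ, (curveOver (E₀ ⊔ ltField ((u : 𝒪[v.adicCompletion K]) * ((2 : ℕ) : 𝒪[v.adicCompletion K])) m :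
        IntermediateField (v.adicCompletion K) (AlgebraicClosure (v.adicCompletion K)))
      ((((⟨1, -1, 0, -2, -1⟩ : WeierstrassCurve ℤ)).map (Int.castRingHom ℤ_[2])).map ((LTCoeff.of (v.adicCompletion K)).toRingHom.comp
        ((integerEquivAdicCompletionIntegers v).trans (padicIntEquivOfDegreeOne K 2 v he hf)).symm.toRingHom))).IsElliptic]
    (xu₀ yu₀ : ℕ → AlgebraicClosure K)
    (XU₀ YU₀ : ∀ m : ℕ, ↥(E₀ ⊔ ltField ((u : 𝒪[v.adicCompletion K]) * ((2 : ℕ) : 𝒪[v.adicCompletion K])) m :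
      IntermediateField (v.adicCompletion K) (AlgebraicClosure (v.adicCompletion K))))
    (hxu₀ : ∀ m : ℕ, algClosureEmb w₀.embedding (xu₀ m) =
      ℘[L] (w₀.embedding ((βr ^ (m + 1) : 𝓞 K) : K) * (ΩE / w₀.embedding (((1 - α₀) ^ 3 : 𝓞 K) : K)) -
        (ΩE / w₀.embedding (((1 - α₀) ^ 3 : 𝓞 K) : K)) / w₀.embedding ((α₀ ^ (m + 1) : 𝓞 K) : K)) -
        (((⟨1, -1, 0, -2, -1⟩ : WeierstrassCurve ℤ)).baseChange ℂ).b₂ / 12)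
    (hyu₀ : ∀ m : ℕ, algClosureEmb w₀.embedding (yu₀ m) =
      (℘'[L] (w₀.embedding ((βr ^ (m + 1) : 𝓞 K) : K) * (ΩE / w₀.embedding (((1 - α₀) ^ 3 : 𝓞 K) : K)) -
          (ΩE / w₀.embedding (((1 - α₀) ^ 3 : 𝓞 K) : K)) / w₀.embedding ((α₀ ^ (m + 1) : 𝓞 K) : K)) -
        (((⟨1, -1, 0, -2, -1⟩ : WeierstrassCurve ℤ)).baseChange ℂ).a₁ *
          (℘[L] (w₀.embedding ((βr ^ (m + 1) : 𝓞 K) : K) * (ΩE / w₀.embedding (((1 - α₀) ^ 3 : 𝓞 K) : K)) -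
            (ΩE / w₀.embedding (((1 - α₀) ^ 3 : 𝓞 K) : K)) / w₀.embedding ((α₀ ^ (m + 1) : 𝓞 K) : K)) -
            (((⟨1, -1, 0, -2, -1⟩ : WeierstrassCurve ℤ)).baseChange ℂ).b₂ / 12) - (((⟨1, -1, 0, -2, -1⟩ : WeierstrassCurve ℤ)).baseChange ℂ).a₃) / 2)
    (hXU₀ : ∀ m, ((XU₀ m : ↥(E₀ ⊔ ltField ((u : 𝒪[v.adicCompletion K]) * ((2 : ℕ) : 𝒪[v.adicCompletion K])) m :
        IntermediateField (v.adicCompletion K) (AlgebraicClosure (v.adicCompletion K)))) : AlgebraicClosure (v.adicCompletion K)) =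
      (absClosureEmbedding K (v.adicCompletion K)).toRingHom (xu₀ m))
    (hYU₀ : ∀ m, ((YU₀ m : ↥(E₀ ⊔ ltField ((u : 𝒪[v.adicCompletion K]) * ((2 : ℕ) : 𝒪[v.adicCompletion K])) m :
        IntermediateField (v.adicCompletion K) (AlgebraicClosure (v.adicCompletion K)))) : AlgebraicClosure (v.adicCompletion K)) =
      (absClosureEmbedding K (v.adicCompletion K)).toRingHom (yu₀ m))
    {a₀ : 𝒪[v.adicCompletion K]ˣ}
    (ha₀ : ∀ (m : ℕ) (h : (curveOver (E₀ ⊔ ltField ((u : 𝒪[v.adicCompletion K]) * ((2 : ℕ) : 𝒪[v.adicCompletion K])) m :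
          IntermediateField (v.adicCompletion K) (AlgebraicClosure (v.adicCompletion K)))
        ((((⟨1, -1, 0, -2, -1⟩ : WeierstrassCurve ℤ)).map (Int.castRingHom ℤ_[2])).map ((LTCoeff.of (v.adicCompletion K)).toRingHom.comp
          ((integerEquivAdicCompletionIntegers v).trans (padicIntEquivOfDegreeOne K 2 v he hf)).symm.toRingHom))).toAffine.Nonsingular
        (XU₀ m) (YU₀ m)),
      ptOfZ (E₀ ⊔ ltField ((u : 𝒪[v.adicCompletion K]) * ((2 : ℕ) : 𝒪[v.adicCompletion K])) m :
          IntermediateField (v.adicCompletion K) (AlgebraicClosure (v.adicCompletion K)))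
          ((((⟨1, -1, 0, -2, -1⟩ : WeierstrassCurve ℤ)).map (Int.castRingHom ℤ_[2])).map ((LTCoeff.of (v.adicCompletion K)).toRingHom.comp
            ((integerEquivAdicCompletionIntegers v).trans (padicIntEquivOfDegreeOne K 2 v he hf)).symm.toRingHom))
          (evalPt₁ (maxNilIdeal (v.adicCompletion K) (E₀ ⊔ ltField ((u : 𝒪[v.adicCompletion K]) * ((2 : ℕ) : 𝒪[v.adicCompletion K])) m :
              IntermediateField (v.adicCompletion K) (AlgebraicClosure (v.adicCompletion K))))
            (hom (isLTRing_LTCoeff (isUniformizer_unit_mul h2 u))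
              (isLTSeries_map_LTCoeff_of_degree_one ((integerEquivAdicCompletionIntegers v).trans (padicIntEquivOfDegreeOne K 2 v he hf))
                hq heπ hPlt) (isLTSeries_LTCoeff _) 1)
            (constantCoeff_hom _ _ _ 1)
            (evalPt₁ (maxNilIdeal (v.adicCompletion K) (E₀ ⊔ ltField ((u : 𝒪[v.adicCompletion K]) * ((2 : ℕ) : 𝒪[v.adicCompletion K])) m :
                IntermediateField (v.adicCompletion K) (AlgebraicClosure (v.adicCompletion K))))
              (hom (isLTRing_LTCoeff (isUniformizer_unit_mul h2 u)) (isLTSeries_LTCoeff _) (isLTSeries_LTCoeff _)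
                (LTCoeff.of (v.adicCompletion K) (a₀ : 𝒪[v.adicCompletion K])))
              (constantCoeff_hom _ _ _ _)
              (inclPt (le_sup_right : ltField ((u : 𝒪[v.adicCompletion K]) * ((2 : ℕ) : 𝒪[v.adicCompletion K])) m ≤
                  E₀ ⊔ ltField ((u : 𝒪[v.adicCompletion K]) * ((2 : ℕ) : 𝒪[v.adicCompletion K])) m)
                (cohPt (isUniformizer_unit_mul h2 u) m)))) =
        (.some (XU₀ m) (YU₀ m) h : (curveOver (E₀ ⊔ ltField ((u : 𝒪[v.adicCompletion K]) * ((2 : ℕ) : 𝒪[v.adicCompletion K])) m :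
            IntermediateField (v.adicCompletion K) (AlgebraicClosure (v.adicCompletion K)))
          ((((⟨1, -1, 0, -2, -1⟩ : WeierstrassCurve ℤ)).map (Int.castRingHom ℤ_[2])).map ((LTCoeff.of (v.adicCompletion K)).toRingHom.comp
            ((integerEquivAdicCompletionIntegers v).trans (padicIntEquivOfDegreeOne K 2 v he hf)).symm.toRingHom))).toAffine.Point))
    -- the LEVEL `𝔪 = (μ) ≤ (v̄³)` prime to `v`; the LABEL `𝔞 = (a)` prime to `𝔪v`, `L′ = 𝔞⁻¹L`, the unit `β`
    {𝔪 : Ideal (𝓞 K)} {μ : 𝓞 K} (hμ0 : μ ≠ 0) (h𝔪μ : 𝔪 = Ideal.span {μ}) (h𝔪π : 𝔪 ≤ Ideal.span {(1 - α₀) ^ 3})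
    (hv𝔪 : ¬ 𝔪 ≤ v.asIdeal)
    {𝔞 : Ideal (𝓞 K)} {a : 𝓞 K} (ha0 : a ≠ 0) (h𝔞a : 𝔞 = Ideal.span {a}) (h𝔞cop : IsCoprime 𝔞 (𝔪 * v.asIdeal))
    (La : PeriodPair) (hLa : La.lattice = idealInvLattice w₀.embedding 𝔞 L.lattice)
    (β : RelNormCoherentUnits (isUniformizer_unit_mul h2 u) E) (xg : ∀ m : ℕ, rayClassField K (𝔪 * v.asIdeal ^ (m + 1)))
    (hxg : ∀ m, IsThetaValueOne w₀.embedding (𝔪 * v.asIdeal ^ (m + 1)) 𝔞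
      (algClosureEmb w₀.embedding ((xg m : rayClassField K (𝔪 * v.asIdeal ^ (m + 1))) : AlgebraicClosure K)))
    (hβv : ∀ m : ℕ, ((((β.val m : unitBall (E ⊔ ltField ((u : 𝒪[v.adicCompletion K]) * ((2 : ℕ) : 𝒪[v.adicCompletion K])) m :
        IntermediateField (v.adicCompletion K) (AlgebraicClosure (v.adicCompletion K)))) :
        (E ⊔ ltField ((u : 𝒪[v.adicCompletion K]) * ((2 : ℕ) : 𝒪[v.adicCompletion K])) m :
          IntermediateField (v.adicCompletion K) (AlgebraicClosure (v.adicCompletion K)))) : AlgebraicClosure (v.adicCompletion K))) =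
      (absClosureEmbedding K (v.adicCompletion K)).toRingHom ((xg m : rayClassField K (𝔪 * v.asIdeal ^ (m + 1))) : AlgebraicClosure K)) :
    ∃ 𝔟' : Ideal (𝓞 K), 𝔟' ≠ ⊥ ∧ IsCoprime 𝔟' (𝔣ψ * (𝔪 * 𝔞) * v.asIdeal) ∧
      absRestrictNormalHom (rayClassField K (𝔣ψ * (𝔪 * 𝔞) * v.asIdeal)) τK⁻¹ =
        artinSymbol (galFrob K (rayClassField K (𝔣ψ * (𝔪 * 𝔞) * v.asIdeal))) 𝔟' ∧
      ∀ k : ℕ,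
        (θ.comp ((CBall (v.adicCompletion K)).subtype.comp (unitBallToCBall E)))
            (PowerSeries.constantCoeff ((fun g : PowerSeries (unitBall E) =>
              (invDiff (isLTRing_LTCoeff (isUniformizer_unit_mul h2 u))
                  (isLTSeries_LTCoeff ((u : 𝒪[v.adicCompletion K]) * ((2 : ℕ) : 𝒪[v.adicCompletion K])))).map
                  (algebraMap (LTCoeff (v.adicCompletion K)) (unitBall E)) *
                PowerSeries.derivative (unitBall E) g)^[k] (relLogDerivSeries (isUniformizer_unit_mul h2 u) E hq hE hσ₀ β))) =
          (θ (algebraMap (v.adicCompletion K) (CompletedAlgClosure (v.adicCompletion K)) ((a₀ : 𝒪[v.adicCompletion K]) : v.adicCompletion K)) *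
              algebraMap (PadicAlgCl 2) ℂ_[2] (ιp.symm (w₀.embedding (((1 - α₀) ^ 3 : 𝓞 K) : K))) /
              algebraMap (PadicAlgCl 2) ℂ_[2] (ιp.symm (w₀.embedding (μ : K)))) ^ (k + 1) *
            ((ιp.symm (-12 * (((Ideal.absNorm 𝔞 : ℕ) : ℂ) * L.eisensteinE (k + 1) (w₀.embedding (ψK 𝔟' : K) * (ΩE / w₀.embedding (μ : K))) -
              La.eisensteinE (k + 1) (w₀.embedding (ψK 𝔟' : K) * (ΩE / w₀.embedding (μ : K))))) : PadicAlgCl 2) : ℂ_[2]) ∧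
        (θ.comp ((CBall (v.adicCompletion K)).subtype.comp (unitBallToCBall E)))
            ((frobUnitBall E σ₀ : unitBall E →+* unitBall E) (PowerSeries.constantCoeff ((fun g : PowerSeries (unitBall E) =>
              (invDiff (isLTRing_LTCoeff (isUniformizer_unit_mul h2 u))
                  (isLTSeries_LTCoeff ((u : 𝒪[v.adicCompletion K]) * ((2 : ℕ) : 𝒪[v.adicCompletion K])))).map
                  (algebraMap (LTCoeff (v.adicCompletion K)) (unitBall E)) *
                PowerSeries.derivative (unitBall E) g)^[k] (relLogDerivSeries (isUniformizer_unit_mul h2 u) E hq hE hσ₀ β)))) =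
          (θ (algebraMap (v.adicCompletion K) (CompletedAlgClosure (v.adicCompletion K)) ((a₀ : 𝒪[v.adicCompletion K]) : v.adicCompletion K)) *
              algebraMap (PadicAlgCl 2) ℂ_[2] (ιp.symm (w₀.embedding (((1 - α₀) ^ 3 : 𝓞 K) : K))) /
              algebraMap (PadicAlgCl 2) ℂ_[2] (ιp.symm (w₀.embedding (μ : K)))) ^ (k + 1) *
            ((ιp.symm (-12 * (((Ideal.absNorm 𝔞 : ℕ) : ℂ) *
                L.eisensteinE (k + 1) (w₀.embedding (ψK (𝔟' * v.asIdeal) : K) * (ΩE / w₀.embedding (μ : K))) -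
              La.eisensteinE (k + 1) (w₀.embedding (ψK (𝔟' * v.asIdeal) : K) * (ΩE / w₀.embedding (μ : K))))) : PadicAlgCl 2) : ℂ_[2]) := by
  -- ### §A the frame at `v`: `v = (α₀)`, `v̄ = (1 − α₀)`, `2 = α₀(1 − α₀)`
  have hprime : Prime α₀ := prime_of_generator hv0
  have h2K : (2 : 𝓞 K) = α₀ * (1 - α₀) := two_eq_generator_mul_one_sub hα₀
  have htr : α₀ + (1 - α₀) = 1 := generator_add_one_sub α₀
  have hπ₁ : ¬ α₀ ∣ 1 - α₀ := not_dvd_one_sub_of_generator hv0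
  have hπ₁0 : (1 - α₀ : 𝓞 K) ≠ 0 := hprime₁.ne_zero; have hπ₁3 : ((1 - α₀) ^ 3 : 𝓞 K) ≠ 0 := pow_ne_zero _ hπ₁0
  have hvπ₁ : ¬ Ideal.span {(1 - α₀ : 𝓞 K)} ≤ v.asIdeal := by
    rw [Ideal.span_singleton_le_iff_mem, hv0, Ideal.mem_span_singleton]; exact hπ₁
  have hπ₀r : ∀ k : ℕ, (α₀ ^ k : 𝓞 K) ∉ Ideal.span {((1 - α₀) ^ 3 : 𝓞 K)} :=
    pow_notMem_of_le_span_pow hprime₁ htr (n := 3) (by norm_num) le_rfl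
  have h2r : (2 : 𝓞 K) ∉ Ideal.span {((1 - α₀) ^ 3 : 𝓞 K)} :=
    two_notMem_of_le_span_sq hprime₁ htr h2K (le_span_sq_of_le_span_cube le_rfl)
  have hr1 : Ideal.span {((1 - α₀) ^ 3 : 𝓞 K)} ≠ ⊤ := ne_top_of_le_span_pow hprime₁ (n := 3) (by norm_num) le_rfl
  -- ### §B the level modulus `𝔪 = (μ)`, `μ = δ·(1 − α₀)³`
  have hμ𝔪 : μ ∈ 𝔪 := h𝔪μ ▸ Ideal.mem_span_singleton_self μ
  have h𝔪0 : 𝔪 ≠ ⊥ := by rw [h𝔪μ]; simpa [Ideal.span_singleton_eq_bot] using hμ0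
  have h𝔪1 : 𝔪 ≠ ⊤ := ne_top_of_le_span_pow hprime₁ (n := 3) (by norm_num) h𝔪π
  have h2𝔪 : (2 : 𝓞 K) ∉ 𝔪 := two_notMem_of_le_span_sq hprime₁ htr h2K (le_span_sq_of_le_span_cube h𝔪π)
  have hπ₀𝔪 : ∀ k : ℕ, (α₀ ^ k : 𝓞 K) ∉ 𝔪 := pow_notMem_of_le_span_pow hprime₁ htr (n := 3) (by norm_num) h𝔪π
  have hα𝔪 : (α₀ : 𝓞 K) ∉ 𝔪 := by simpa using hπ₀𝔪 1
  have hμv : μ ∉ v.asIdeal := fun h ↦ hv𝔪 (by rw [h𝔪μ]; exact (Ideal.span_singleton_le_iff_mem _).mpr h)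
  obtain ⟨δ, hδμ⟩ := Ideal.mem_span_singleton'.mp (h𝔪π hμ𝔪)
  have hδ0 : δ ≠ 0 := fun h ↦ hμ0 (by rw [← hδμ, h, zero_mul])
  have hδv : δ ∉ v.asIdeal := fun h ↦ hμv (by rw [← hδμ]; exact v.asIdeal.mul_mem_right _ h)
  have h𝔪δ : 𝔪 ≤ Ideal.span {δ} := by
    rw [h𝔪μ, Ideal.span_singleton_le_span_singleton]; exact ⟨(1 - α₀) ^ 3, by rw [← hδμ]⟩
  -- ### §C the label `𝔞 = (a)` prime to `𝔪v`; the reading conductor `𝔠r = 𝔪𝔞`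
  have h𝔞0 : 𝔞 ≠ ⊥ := by rw [h𝔞a]; simpa [Ideal.span_singleton_eq_bot] using ha0
  have h𝔞𝔪 : IsCoprime 𝔞 𝔪 := h𝔞cop.of_mul_right_left; have h𝔞v : IsCoprime 𝔞 v.asIdeal := h𝔞cop.of_mul_right_right
  have hv𝔞 : ¬ 𝔞 ≤ v.asIdeal := fun h ↦ v.isPrime.ne_top (by
    have h1 := Ideal.isCoprime_iff_sup_eq.mp h𝔞v; rwa [sup_eq_right.mpr h] at h1)
  have hav : a ∉ v.asIdeal := fun h ↦ hv𝔞 (by rw [h𝔞a]; exact (Ideal.span_singleton_le_iff_mem _).mpr h)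
  have h𝔠r0 : 𝔪 * 𝔞 ≠ ⊥ := mul_ne_zero h𝔪0 h𝔞0
  have h𝔠r𝔪 : 𝔪 * 𝔞 ≤ 𝔪 := Ideal.mul_le_right; have h𝔠r𝔞 : 𝔪 * 𝔞 ≤ 𝔞 := Ideal.mul_le_left
  have hv𝔠r : ¬ 𝔪 * 𝔞 ≤ v.asIdeal := fun h ↦ (v.isPrime.mul_le.mp h).elim hv𝔪 hv𝔞
  have h𝔣𝔠0 : 𝔣ψ * (𝔪 * 𝔞) ≠ ⊥ := mul_ne_zero h𝔣ψ0 h𝔠r0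
  have hv𝔣𝔠 : ¬ 𝔣ψ * (𝔪 * 𝔞) ≤ v.asIdeal := fun h ↦ (v.isPrime.mul_le.mp h).elim hv𝔣ψ hv𝔠r
  obtain ⟨βK, hβK⟩ := exists_mul_generator_sub_one_mem hv𝔠r hv0
  -- ### §D the scales `Ω_𝔪 = Ω_E/w₀ μ`, `Ω_ref = Ω_E/w₀ (1 − α₀)³ = w₀(δ)·Ω_𝔪` and the two presentations of `Λ_L`
  set Ω' : ℂ := ΩE / w₀.embedding (μ : K) with hΩ'def
  set Ωr : ℂ := ΩE / w₀.embedding (((1 - α₀) ^ 3 : 𝓞 K) : K) with hΩrdef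
  have hΩ' : Ω' ≠ 0 := modelLattice_scale_ne_zero w₀.embedding hΩE hμ0; have hΩr : Ωr ≠ 0 := modelLattice_scale_ne_zero w₀.embedding hΩE hπ₁3
  have hL' : ∀ z : ℂ, z ∈ L.lattice ↔ ∃ t ∈ 𝔪, z = Ω' * w₀.embedding (t : K) :=
    modelLattice_spec_of_span_singleton_eq w₀.embedding hLE hμ0 h𝔪μ
  have hLr : ∀ z : ℂ, z ∈ L.lattice ↔ ∃ t ∈ Ideal.span {((1 - α₀) ^ 3 : 𝓞 K)}, z = Ωr * w₀.embedding (t : K) :=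
    modelLattice_spec_of_span_singleton_eq w₀.embedding hLE hπ₁3 rfl
  have hΛ : IsCMLattice w₀.embedding L.lattice := isCMLattice_of_model w₀.embedding hL'
  have hΩrL : Ωr ∉ L.lattice := notMem_lattice_of_model w₀.embedding hLr hΩr hr1
  have hwμ : w₀.embedding (μ : K) ≠ 0 := (map_ne_zero _).mpr (by exact_mod_cast hμ0); have hμK : ((((1 - α₀) ^ 3 : 𝓞 K) : K) * (δ : K) : K) = (μ : K) := by rw [← hδμ]; push_cast; ring
  have hwδ : w₀.embedding (δ : K) ≠ 0 := (map_ne_zero _).mpr (by exact_mod_cast hδ0)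
  have hΩδ : Ωr = w₀.embedding (δ : K) * Ω' := by
    rw [hΩrdef, hΩ'def, ← hμK, map_mul]; field_simp
  -- ### §E the reading modulus `𝔑 = 𝔣ψ·𝔪·(1 − α₀)`
  have h𝔑0 : 𝔣ψ * (𝔪 * Ideal.span {(1 - α₀ : 𝓞 K)}) ≠ ⊥ :=
    mul_ne_zero h𝔣ψ0 (mul_ne_zero h𝔪0 (by simpa [Ideal.span_singleton_eq_bot] using hπ₁0))
  have hv𝔑 : ¬ 𝔣ψ * (𝔪 * Ideal.span {(1 - α₀ : 𝓞 K)}) ≤ v.asIdeal := fun h ↦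
    (v.isPrime.mul_le.mp h).elim hv𝔣ψ (fun h' ↦ (v.isPrime.mul_le.mp h').elim hv𝔪 hvπ₁)
  -- ### §F the enlarged reading field `E* ⊇ E ⊔ E₀ ⊔ K_v(ζ_{2^{f*}−1}) ⊔ e(K(𝔣ψ𝔪𝔞))` with its `α`-datum
  obtain ⟨Es, hfdEs, hgalEs, hEEs, hE₀Es, hEsu, hEs, fs, hαs0, hfs, hαsw, hαsπ, hdegEs⟩ :=
    exists_readingField E E₀ hE hE₀ h𝔣𝔠0 hv𝔣𝔠 h𝔑0 hv𝔑 hv0 u hu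
  haveI := hfdEs; haveI := hgalEs
  haveI hEllEs : ∀ m : ℕ, (curveOver (Es ⊔ ltField ((u : 𝒪[v.adicCompletion K]) * ((2 : ℕ) : 𝒪[v.adicCompletion K])) m :
      IntermediateField (v.adicCompletion K) (AlgebraicClosure (v.adicCompletion K)))
      ((((⟨1, -1, 0, -2, -1⟩ : WeierstrassCurve ℤ)).map (Int.castRingHom ℤ_[2])).map ((LTCoeff.of (v.adicCompletion K)).toRingHom.comp
        ((integerEquivAdicCompletionIntegers v).trans (padicIntEquivOfDegreeOne K 2 v he hf)).symm.toRingHom))).IsElliptic := fun m ↦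
    isElliptic_curveOver_map_map _ _ _ (by rw [cm7Model_Δ]; norm_num)
  -- ### §G the algebraic theta data of the label, read at `E*`
  obtain ⟨ca, hca, -⟩ := exists_tateUnit_reading_of_not_mem (v := v) he hf hav
  obtain ⟨X₀, Y₀, X₁, Y₁, S, Xc, hS, hX₀, hY₀, hX₁, hY₁, hX₀i, hY₀i, hX₁i, hY₁i, hKcK, hKci, hXc, hXci, hXcu, hcard⟩ :=
    exists_thetaData_of_label w₀ L hL' hΩ' h𝔪0 h𝔪1 h₂ h₃ hα𝔪 ha0 h𝔞a h𝔞𝔪 hv𝔠r ca hca La hLa hK h6 Es hEs hIx hIy hIu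
  -- ### §H the label ideal `𝔟′`
  obtain ⟨𝔟', δ', h𝔟'0, h𝔟'cop, h𝔟'artv, hg, hδ', hψv𝔟', hΩb, hΩb', hvii⟩ :=
    exists_labelIdeal w₀ τK L hL' hΩ' h𝔪0 h𝔪1 hv𝔪 hv0 h𝔞0 h𝔞𝔪 hv𝔞 La hLa ψK h𝔣ψ0 hv𝔣ψ hψmul hψspan hψv h7
  -- a `v̄`-division point and `2Ω_𝔪, 2α₀Ω_𝔪 ∉ L`
  obtain ⟨ub, hub1, hub0⟩ := exists_mul_mem_and_notMem w₀.embedding L hL' hΩ' h𝔪0 hprime₁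
    (h𝔪π.trans (Ideal.span_singleton_le_span_singleton.mpr (dvd_pow_self _ three_ne_zero)))
  have e2 : w₀.embedding ((2 : 𝓞 K) : K) = 2 := by rw [show ((2 : 𝓞 K) : K) = 2 from rfl, map_ofNat]
  have h2Ω : (2 : ℂ) * Ω' ∉ L.lattice := by
    have h := mul_gen_notMem w₀.embedding hL' hΩ' h2𝔪
    rwa [e2] at h
  have h2α : (α₀ * 2 : 𝓞 K) ∉ 𝔪 := by
    intro h
    have h1 : (1 - α₀) ^ 2 ∣ α₀ * 2 := Ideal.mem_span_singleton.mp (le_span_sq_of_le_span_cube h𝔪π h)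
    rw [h2K, ← mul_assoc, pow_two, mul_dvd_mul_iff_right hπ₁0] at h1
    exact not_dvd_of_add_eq_one hprime₁ htr (hprime₁.dvd_of_dvd_pow (n := 2) (by rw [pow_two]; exact h1))
  have h2Ω₁ : (2 : ℂ) * (w₀.embedding (α₀ : K) * Ω') ∉ L.lattice := by
    have h := mul_gen_notMem w₀.embedding hL' hΩ' h2α
    have e1 : w₀.embedding ((α₀ * 2 : 𝓞 K) : K) * Ω' = 2 * (w₀.embedding (α₀ : K) * Ω') := by push_cast; rw [map_mul, e2]; ring
    rwa [e1] at h
  -- ### §I FILE-1 at `E*` for the base-changed unit `β ⊗ E*`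
  obtain ⟨xu, yu, XU, YU, as, hxu, hyu, hXU, hYU, has, hval⟩ :=
    exists_tateUnit_and_forall_readingHom_moment_eq_of_readingField v he hf hq h2 u hPexp hA hPlt heπ (⟨1, -1, 0, -2, -1⟩ : WeierstrassCurve ℤ)
      rfl hV hp hϖ Es hEsu hσ₀ hEs h𝔣𝔠0 hv𝔣𝔠 h𝔑0 hv𝔑 hαs0 hfs hαsw hαsπ hdegEs θ ιp w₀ hτK hv0 h2K htr hprime hπ₁ hc hw h𝔪1 hprime₁
      h𝔪π h𝔠r𝔪 hβK le_rfl (fun _ : Unit ↦ β.baseChange (isUniformizer_unit_mul h2 u) hq hEEs hEsu hσ₀) (fun _ ↦ 𝔞) (fun _ ↦ h𝔠r𝔞)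
      (fun _ ↦ xg) (fun _ ↦ hxg) (fun _ m ↦ by rw [RelNormCoherentUnits.coe_val_baseChange, IntermediateField.coe_inclusion]; exact hβv m)
      L (fun _ ↦ La) (fun _ ↦ S) (fun _ ↦ hS) (fun _ ↦ hLa) hL' hΩ' h₂ h₃ hub1 hub0 h2Ω h2Ω₁ ψK hψv h6
      h𝔟'0 hg hvii hδ' (fun _ ↦ hΩb) (fun _ ↦ hΩb') X₀ Y₀ X₁ Y₁ hX₀ hY₀ hX₁ hY₁ hX₀i hY₀i hX₁i hY₁i
      (fun _ ↦ (((a : K) ^ 12)⁻¹ * (-343) ^ (S.card - 1) : K)) (fun _ ↦ hKcK) (fun _ ↦ hKci) (fun _ ↦ Xc) (fun _ ↦ hXc) (fun _ c' ↦ hXci c')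
      (fun _ ↦ hXcu)
  -- ### §J [I4]: the Tate unit `a*` against the reference (U4 transport `E₀ ≤ E*`, then TATE-UNIT-CM at the lane)
  have hu₀L : ∀ m : ℕ, w₀.embedding ((βr ^ (m + 1) : 𝓞 K) : K) * Ωr - Ωr / w₀.embedding ((α₀ ^ (m + 1) : 𝓞 K) : K) ∉ L.lattice := fun m ↦
    divisionPt_succ_notMem w₀.embedding hLr hΩr h2K hprime hπ₁ m
  have hn₀ : ∀ m : ℕ, (curveOver (E₀ ⊔ ltField ((u : 𝒪[v.adicCompletion K]) * ((2 : ℕ) : 𝒪[v.adicCompletion K])) m :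
        IntermediateField (v.adicCompletion K) (AlgebraicClosure (v.adicCompletion K)))
      ((((⟨1, -1, 0, -2, -1⟩ : WeierstrassCurve ℤ)).map (Int.castRingHom ℤ_[2])).map ((LTCoeff.of (v.adicCompletion K)).toRingHom.comp
        ((integerEquivAdicCompletionIntegers v).trans (padicIntEquivOfDegreeOne K 2 v he hf)).symm.toRingHom))).toAffine.Nonsingular
      (XU₀ m) (YU₀ m) := fun m ↦
    nonsingular_curveOver_of_readings ((integerEquivAdicCompletionIntegers v).trans (padicIntEquivOfDegreeOne K 2 v he hf)) _ _
      (algClosureEmb w₀.embedding) (absClosureEmbedding K (v.adicCompletion K)).toRingHom L h₂ h₃ (hu₀L m) (hxu₀ m) (hyu₀ m) (hXU₀ m) (hYU₀ m)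
  have ha₀' := forall_ptOfZ_hom_hom_cohPt_eq_of_le ((integerEquivAdicCompletionIntegers v).trans (padicIntEquivOfDegreeOne K 2 v he hf)) hq
    (isUniformizer_unit_mul h2 u) heπ hPlt (((⟨1, -1, 0, -2, -1⟩ : WeierstrassCurve ℤ)).map (Int.castRingHom ℤ_[2])) E₀ Es hE₀Es XU₀ YU₀ hn₀
    (a := (a₀ : 𝒪[v.adicCompletion K])) (fun m ↦ ha₀ m (hn₀ m))
  -- the reference base point `ξ(Ω_ref)` and the `δ`-torsion coordinates, read at `K(𝔣ψ𝔪𝔞)` (`𝔪𝔞 ≤ 𝔪 ≤ (δ) ≤ (v̄³)`)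
  have hΩr𝔠 : Ωr ∈ idealInvLattice w₀.embedding (𝔪 * 𝔞) L.lattice := mem_idealInvLattice_iff.mpr fun t ht ↦
    mem_idealInvLattice_iff.mp (mem_idealInvLattice_of_model w₀.embedding hLr) t ((h𝔠r𝔪.trans h𝔪π) ht)
  obtain ⟨xr, yr, hxr, hyr⟩ := h6 _ h𝔠r0 Ωr hΩr𝔠 hΩrL
  obtain ⟨hXr, hYr⟩ := algClosureEmb_modelCoords w₀.embedding (rayClassField K (𝔣ψ * (𝔪 * 𝔞))) hxr hyr
  have hXri := hIx _ h𝔠r0 hv𝔠r Ωr hΩr𝔠 hΩrL Es hEs _ hXr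
  have hYri := hIy _ h𝔠r0 hv𝔠r Ωr hΩr𝔠 hΩrL Es hEs _ hYr
  have hXδ : ∀ c' : ℂ, w₀.embedding (δ : K) * c' ∈ L.lattice → c' ∉ L.lattice →
      ∃ X : rayClassField K (𝔣ψ * (𝔪 * 𝔞)), X ∈ readingRing Es hEs ∧
        algClosureEmb w₀.embedding X = ℘[L] c' - (((⟨1, -1, 0, -2, -1⟩ : WeierstrassCurve ℤ)).baseChange ℂ).b₂ / 12 := by
    intro c' hc' hc'L
    have hc1 : c' ∈ idealInvLattice w₀.embedding (𝔪 * 𝔞) L.lattice := mem_idealInvLattice_iff.mpr fun t ht ↦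
      mem_idealInvLattice_iff.mp ((mem_idealInvLattice_span_singleton hΛ δ).mpr hc') t ((h𝔠r𝔪.trans h𝔪δ) ht)
    obtain ⟨xc, yc, hxc, hyc⟩ := h6 _ h𝔠r0 c' hc1 hc'L
    obtain ⟨hXc', -⟩ := algClosureEmb_modelCoords w₀.embedding (rayClassField K (𝔣ψ * (𝔪 * 𝔞))) hxc hyc
    exact ⟨_, hIx _ h𝔠r0 hv𝔠r c' hc1 hc'L Es hEs _ hXc', hXc'⟩
  obtain ⟨cδ, hcδ, hac⟩ := tateUnit_eq_mul_of_lane_of_torsionReadings he hf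
    ((integerEquivAdicCompletionIntegers v).trans (padicIntEquivOfDegreeOne K 2 v he hf)) rfl hq (isUniformizer_unit_mul h2 u) heπ hA hPlt
    hPexp (⟨1, -1, 0, -2, -1⟩ : WeierstrassCurve ℤ) rfl Es w₀.embedding L h₂ h₃ hLr hL' h𝔪π hδv hΩ' hΩδ hβr (h𝔠r𝔪 hβK) hv0 h2K hprime hπ₁
    hπ₀r hπ₀𝔪 h2r hEs X₀ Y₀ _ _ hX₀ hY₀ hXr hYr hX₀i hY₀i hXri hYri hXδ h6 h𝔑0 hv𝔑 (Ideal.mul_mono_right Ideal.mul_le_right) hαs0 hfs hαsw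
    hαsπ hdegEs xu₀ yu₀ xu yu (fun m ↦ IntermediateField.inclusion (sup_le_sup_right hE₀Es _) (XU₀ m))
    (fun m ↦ IntermediateField.inclusion (sup_le_sup_right hE₀Es _) (YU₀ m)) XU YU hxu₀ hyu₀
    (fun m ↦ by rw [IntermediateField.coe_inclusion]; exact hXU₀ m) (fun m ↦ by rw [IntermediateField.coe_inclusion]; exact hYU₀ m)
    hxu hyu hXU hYU
    (fun m h ↦ ha₀' m _ _ rfl rfl h) has
  -- the constant: `θ(a*) = θ(a₀)·Φ((1 − α₀)³)/Φ(μ)` (explicit rewriting only: `θ(a₀) = Φ(δ)·θ(a*)`, `Φ(μ) = Φ((1 − α₀)³)·Φ(δ)`)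
  have hΦμ : algebraMap (PadicAlgCl 2) ℂ_[2] (ιp.symm (w₀.embedding (μ : K))) ≠ 0 := by
    rw [map_ne_zero_iff _ (algebraMap (PadicAlgCl 2) ℂ_[2]).injective, map_ne_zero_iff _ ιp.symm.injective]; exact hwμ
  have hθδ : θ (algebraMap (v.adicCompletion K) (CompletedAlgClosure (v.adicCompletion K)) ((cδ : 𝒪[v.adicCompletion K]) : v.adicCompletion K)) =
      algebraMap (PadicAlgCl 2) ℂ_[2] (ιp.symm (w₀.embedding (δ : K))) := by
    rw [hcδ, HeightOneSpectrum.algebraMap_adicCompletion, Function.comp_apply, Algebra.algebraMap_self_apply]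
    exact theta_algebraMap_eq_of_reading_conj θ ιp w₀ hτK (δ : K)
  have hθas : θ (algebraMap (v.adicCompletion K) (CompletedAlgClosure (v.adicCompletion K)) ((as : 𝒪[v.adicCompletion K]) : v.adicCompletion K)) =
      θ (algebraMap (v.adicCompletion K) (CompletedAlgClosure (v.adicCompletion K)) ((a₀ : 𝒪[v.adicCompletion K]) : v.adicCompletion K)) *
        algebraMap (PadicAlgCl 2) ℂ_[2] (ιp.symm (w₀.embedding (((1 - α₀) ^ 3 : 𝓞 K) : K))) /
        algebraMap (PadicAlgCl 2) ℂ_[2] (ιp.symm (w₀.embedding (μ : K))) := by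
    have h1 : ((a₀ : 𝒪[v.adicCompletion K]) : v.adicCompletion K) =
        ((cδ : 𝒪[v.adicCompletion K]) : v.adicCompletion K) * ((as : 𝒪[v.adicCompletion K]) : v.adicCompletion K) := by
      rw [hac, Units.val_mul, Subring.coe_mul]
    rw [eq_div_iff hΦμ, h1, map_mul, map_mul, hθδ, ← hμK, map_mul, map_mul, map_mul]
    ring
  -- ### §K the descent of the moments `E* → E` and the assembly
  refine ⟨𝔟', h𝔟'0, h𝔟'cop, h𝔟'artv, fun k ↦ ?_⟩
  obtain ⟨hv1, hv2⟩ := hval () k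
  have hd1 := unitBallToCBall_moment_baseChange (isUniformizer_unit_mul h2 u) hq hEEs hEsu hσ₀
    (invDiff (isLTRing_LTCoeff (isUniformizer_unit_mul h2 u)) (isLTSeries_LTCoeff ((u : 𝒪[v.adicCompletion K]) * ((2 : ℕ) : 𝒪[v.adicCompletion K])))) β k
  have hd2 := unitBallToCBall_frob_moment_baseChange (isUniformizer_unit_mul h2 u) hq hEEs hEsu hσ₀
    (invDiff (isLTRing_LTCoeff (isUniformizer_unit_mul h2 u)) (isLTSeries_LTCoeff ((u : 𝒪[v.adicCompletion K]) * ((2 : ℕ) : 𝒪[v.adicCompletion K])))) β k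
  simp only [RingHom.comp_apply, Subring.coe_subtype] at hv1 hv2 ⊢
  rw [← hd1, hv1, ← hd2, hv2, hθas, hcard]
  exact ⟨rfl, rfl⟩

end Summit.BirchSwinnertonDyer.BirchSwinnertonDyer.Theorems.PrintCf2.KatzMeasureJZeroSeam

end
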